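import Summits.ValiantsHypothesis.ValiantsHypothesis.Theorems.BarrierLeverPartitionMinorsChowComplementaryProducts

/-!
# Route BarrierLever — items 20195 / 20172: the x-private design on DOWN-CLOSED columns — the
# truncated-inverse matrix `Θ̂` (Γ-reduction)

Helper file (`--supports stmt-ValiantsHypothesis-20195`; cell valiant-natproofs, rung V4, 𝒟-side of
door (c); seat val-np-p2 gen 8).  Closes NO item; definition-free; general coefficient ring `R`.
Conventions of items 19717 / 20172 / 20195: `x_a = X (castAdd h a)`, `y_c = X (natAdd h c)`,
`E u w = Σ_{a∈u} e_{x_a} + Σ_{c∈w} e_{y_c}`.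

After the cube reduction (`…ChowCubeReduction[Door]`) items 20195 / 20172 are statements about
products of `h` affine forms against DOWN-CLOSED column families `δ`.  For the x-PRIVATE design
`g = ∏_a (x_a + A_a)`, `A_a = 1 + Σ_c q_{a c} y_c`, the entry is `coeff_{E ∅ T} ∏_{a ∉ U} A_a`
(`ChowFactor.coeff_partitionExpo_xPrivate`).  With the TRUNCATED INVERSES
`t_a = Σ_S (-1)^{|S|} |S|! q_a^S · y^S` (`coeff_tinv`; `t_a · A_a ≡ 1` on squarefree monomials,
`coeff_mul_tinv_mul_affine`) one has, on squarefree monomials, `∏_{a∉U} A_a ≡ G · ∏_{a∈U} t_a`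
(`G = ∏_a A_a`; `coeff_xPrivate_eq_G_mul_tinv`), hence for a down-closed injective `δ` the matrix
factorises as `Θ̂ · Γ` with `Θ̂[i,j] = coeff_{E ∅ (δ j)} ∏_{a ∈ u i} t_a` and `Γ` unitriangular in the
containment order (`xPrivate_matrix_eq_thetaHat_mul`, `det_gamma_eq_one`):

  **`det[coeff_{E (u i) (δ j)} ∏_a (x_a + A_a)] = det Θ̂[u, δ]`** (`det_xPrivate_eq_det_thetaHat`).

`Θ̂` is explicit (rows `∅`, `{a}`: `thetaHat_empty_row`, `thetaHat_singleton_row`; row `{a,b}`: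
`(-1)^{|T|} Σ_{S ⊆ T} |S|! |T∖S|! q_a^S q_b^{T∖S}` = `(|T|+1)! ×` the average of `y^T` over the segment
`[q_a, q_b]`).  The peeling calculus for `det Θ̂ ≠ 0` is in `…ChowCubeThetaHatPeel`.

WHAT THIS IS NOT: bookkeeping; items 20195 / 20172 / 19717 stay open; nothing on crux
stmt-ValiantsHypothesis-14610 or on `VP` versus `VNP`.
-/

set_option linter.dupNamespace false

namespace Summit.ValiantsHypothesis.ValiantsHypothesis.Theorems.BarrierLever.ChowCube

open Finset MvPolynomial
open Summit.ValiantsHypothesis.ValiantsHypothesis.Theorems.BarrierLever.ChowFactor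
  (coeff_partitionExpo_mul_yOnly coeff_partitionExpo_mul_affineY coeff_partitionExpo_xPrivate
    support_castAdd_eq_zero_of_vars castAdd_notMem_vars_mul castAdd_notMem_vars_prod)
open Summit.ValiantsHypothesis.ValiantsHypothesis.Theorems.BarrierLever.ProductStateSums
  (castAdd_ne_natAdd partitionExpo_apply_castAdd partitionExpo_apply_natAdd)
open Summit.ValiantsHypothesis.ValiantsHypothesis.Theorems.BarrierLever.CorankRepair (partitionExpo_eq_iff)

variable {R : Type*} [CommRing R] {h : ℕ}

/-! ## 1. Truncated inverses of affine `y`-forms -/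

/-- Coefficients of the **truncated inverse** `t(b) = Σ_S (-1)^{|S|} |S|! (∏_{c∈S} b c) · y^S`:
`coeff (E ∅ S') t(b) = (-1)^{|S'|} |S'|! ∏_{c∈S'} b c`. -/
theorem coeff_tinv (b : Fin h → R) (S' : Finset (Fin h)) :
    coeff (∑ a ∈ (∅ : Finset (Fin h)), Finsupp.single (Fin.castAdd h a) 1 +
        ∑ c ∈ S', Finsupp.single (Fin.natAdd h c) 1)
        (∑ S ∈ (Finset.univ : Finset (Fin h)).powerset,
          monomial (∑ a ∈ (∅ : Finset (Fin h)), Finsupp.single (Fin.castAdd h a) 1 +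
            ∑ c ∈ S, Finsupp.single (Fin.natAdd h c) 1)
            ((-1 : R) ^ S.card * (S.card.factorial : R) * ∏ c ∈ S, b c)) =
      (-1 : R) ^ S'.card * (S'.card.factorial : R) * ∏ c ∈ S', b c := by
  classical
  rw [coeff_sum]
  simp only [coeff_monomial]
  have key : ∀ S ∈ (Finset.univ : Finset (Fin h)).powerset,
      (if (∑ a ∈ (∅ : Finset (Fin h)), Finsupp.single (Fin.castAdd h a) 1 +
            ∑ c ∈ S, Finsupp.single (Fin.natAdd h c) 1 : Fin (h + h) →₀ ℕ) =
          ∑ a ∈ (∅ : Finset (Fin h)), Finsupp.single (Fin.castAdd h a) 1 +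
            ∑ c ∈ S', Finsupp.single (Fin.natAdd h c) 1
        then (-1 : R) ^ S.card * (S.card.factorial : R) * ∏ c ∈ S, b c else 0) =
      if S = S' then (-1 : R) ^ S'.card * (S'.card.factorial : R) * ∏ c ∈ S', b c else 0 := by
    intro S _
    by_cases hS : S = S'
    · subst hS; simp
    · rw [if_neg, if_neg hS]
      intro e
      exact hS ((partitionExpo_eq_iff ∅ S ∅ S').mp e).2
  rw [Finset.sum_congr rfl key, Finset.sum_ite_eq']
  simp

/-- The truncated inverse involves no `x`-variable. -/
theorem castAdd_notMem_vars_tinv (b : Fin h → R) :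
    ∀ a : Fin h, Fin.castAdd h a ∉ (∑ S ∈ (Finset.univ : Finset (Fin h)).powerset,
      monomial (∑ a' ∈ (∅ : Finset (Fin h)), Finsupp.single (Fin.castAdd h a') 1 +
        ∑ c ∈ S, Finsupp.single (Fin.natAdd h c) 1)
        ((-1 : R) ^ S.card * (S.card.factorial : R) * ∏ c ∈ S, b c) :
          MvPolynomial (Fin (h + h)) R).vars := by
  classical
  intro a ha
  obtain ⟨S, -, hS⟩ := Finset.mem_biUnion.mp (vars_sum_subset _ _ ha)
  obtain ⟨d, hd, had⟩ := (mem_vars_iff_mem_support _).mp hS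
  have hd' : d = ∑ a' ∈ (∅ : Finset (Fin h)), Finsupp.single (Fin.castAdd h a') 1 +
      ∑ c ∈ S, Finsupp.single (Fin.natAdd h c) 1 :=
    Finset.mem_singleton.mp (support_monomial_subset hd)
  rw [hd', Finsupp.mem_support_iff, partitionExpo_apply_castAdd] at had
  simp at had

/-- The affine `y`-form `1 + Σ_c b_c y_c` involves no `x`-variable. -/
theorem castAdd_notMem_vars_affineY (b : Fin h → R) :
    ∀ a : Fin h, Fin.castAdd h a ∉
      ((1 + ∑ c, C (b c) * X (Fin.natAdd h c)) : MvPolynomial (Fin (h + h)) R).vars := by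
  classical
  intro a ha
  have h1 := vars_add_subset (1 : MvPolynomial (Fin (h + h)) R) _ ha
  rw [vars_one, Finset.empty_union] at h1
  obtain ⟨c, -, hc⟩ := Finset.mem_biUnion.mp (vars_sum_subset _ _ h1)
  rw [C_mul_X_eq_monomial] at hc
  obtain ⟨d, hd, had⟩ := (mem_vars_iff_mem_support _).mp hc
  have hd' : d = Finsupp.single (Fin.natAdd h c) 1 := Finset.mem_singleton.mp (support_monomial_subset hd)
  rw [hd', Finsupp.mem_support_iff, Finsupp.single_apply, if_neg (castAdd_ne_natAdd a c).symm] at had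
  exact had rfl

/-- **`t(b) · (1 + Σ_c b_c y_c) ≡ 1` on squarefree monomials**:
`coeff (E ∅ U) (t(b) · (1 + Σ_c b_c y_c)) = [U = ∅]`
(the identity `(-1)^n n! + n · (-1)^{n-1} (n-1)! = 0`). -/
theorem coeff_tinv_mul_affineY (b : Fin h → R) (U : Finset (Fin h)) :
    coeff (∑ a ∈ (∅ : Finset (Fin h)), Finsupp.single (Fin.castAdd h a) 1 +
        ∑ c ∈ U, Finsupp.single (Fin.natAdd h c) 1)
        ((∑ S ∈ (Finset.univ : Finset (Fin h)).powerset,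
          monomial (∑ a ∈ (∅ : Finset (Fin h)), Finsupp.single (Fin.castAdd h a) 1 +
            ∑ c ∈ S, Finsupp.single (Fin.natAdd h c) 1)
            ((-1 : R) ^ S.card * (S.card.factorial : R) * ∏ c ∈ S, b c)) *
          (1 + ∑ c, C (b c) * X (Fin.natAdd h c))) =
      if U = ∅ then 1 else 0 := by
  classical
  rw [coeff_partitionExpo_mul_affineY, coeff_tinv]
  simp only [coeff_tinv]
  by_cases hU0 : U = ∅
  · subst hU0
    simp
  rw [if_neg hU0]
  have hterm : ∀ c ∈ U, b c * ((-1 : R) ^ (U.erase c).card * (((U.erase c).card.factorial : ℕ) : R) *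
      ∏ c' ∈ U.erase c, b c') = (-1 : R) ^ (U.card - 1) * (((U.card - 1).factorial : ℕ) : R) *
        ∏ c' ∈ U, b c' := by
    intro c hc
    rw [Finset.card_erase_of_mem hc, ← Finset.prod_erase_mul U (fun c' => b c') hc]
    ring
  rw [Finset.sum_congr rfl hterm, Finset.sum_const]
  obtain ⟨n, hn⟩ : ∃ n, U.card = n + 1 := ⟨U.card - 1, by
    have := Finset.card_pos.mpr (Finset.nonempty_iff_ne_empty.mpr hU0); omega⟩
  rw [hn, Nat.add_sub_cancel, Nat.factorial_succ, nsmul_eq_mul]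
  push_cast
  ring

/-- **Multiplying by `t(b) · (1 + Σ_c b_c y_c)` does not change squarefree coefficients**:
`coeff (E V W) (F · (t(b) · (1 + Σ_c b_c y_c))) = coeff (E V W) F`. -/
theorem coeff_mul_tinv_mul_affineY (F : MvPolynomial (Fin (h + h)) R) (b : Fin h → R)
    (V W : Finset (Fin h)) :
    coeff (∑ a ∈ V, Finsupp.single (Fin.castAdd h a) 1 + ∑ c ∈ W, Finsupp.single (Fin.natAdd h c) 1)
        (F * ((∑ S ∈ (Finset.univ : Finset (Fin h)).powerset,
          monomial (∑ a ∈ (∅ : Finset (Fin h)), Finsupp.single (Fin.castAdd h a) 1 +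
            ∑ c ∈ S, Finsupp.single (Fin.natAdd h c) 1)
            ((-1 : R) ^ S.card * (S.card.factorial : R) * ∏ c ∈ S, b c)) *
          (1 + ∑ c, C (b c) * X (Fin.natAdd h c)))) =
      coeff (∑ a ∈ V, Finsupp.single (Fin.castAdd h a) 1 +
        ∑ c ∈ W, Finsupp.single (Fin.natAdd h c) 1) F := by
  classical
  have hy : ∀ a : Fin h, Fin.castAdd h a ∉ ((∑ S ∈ (Finset.univ : Finset (Fin h)).powerset,
      monomial (∑ a ∈ (∅ : Finset (Fin h)), Finsupp.single (Fin.castAdd h a) 1 +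
        ∑ c ∈ S, Finsupp.single (Fin.natAdd h c) 1)
        ((-1 : R) ^ S.card * (S.card.factorial : R) * ∏ c ∈ S, b c)) *
      (1 + ∑ c, C (b c) * X (Fin.natAdd h c)) : MvPolynomial (Fin (h + h)) R).vars :=
    castAdd_notMem_vars_mul _ _ (castAdd_notMem_vars_tinv b) (castAdd_notMem_vars_affineY b)
  rw [coeff_partitionExpo_mul_yOnly F _ (support_castAdd_eq_zero_of_vars _ hy) V W]
  simp_rw [coeff_tinv_mul_affineY, mul_ite, mul_one, mul_zero]
  rw [Finset.sum_ite_eq' W.powerset ∅]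
  rw [if_pos (Finset.mem_powerset.mpr (Finset.empty_subset W)), Finset.sdiff_empty]


/-! ## 2. The x-private design on squarefree monomials: `∏_{a ∉ U} A_a ≡ G · ∏_{a ∈ U} t_a` -/

/-- Multiplying by any product of the factors `t_a · A_a` does not change squarefree coefficients. -/
theorem coeff_mul_prod_tinv_mul_affineY (F : MvPolynomial (Fin (h + h)) R) (q : Fin h → Fin h → R)
    (U V W : Finset (Fin h)) :
    coeff (∑ a ∈ V, Finsupp.single (Fin.castAdd h a) 1 + ∑ c ∈ W, Finsupp.single (Fin.natAdd h c) 1)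
        (F * ∏ a ∈ U, ((∑ S ∈ (Finset.univ : Finset (Fin h)).powerset,
          monomial (∑ a' ∈ (∅ : Finset (Fin h)), Finsupp.single (Fin.castAdd h a') 1 +
            ∑ c ∈ S, Finsupp.single (Fin.natAdd h c) 1)
            ((-1 : R) ^ S.card * (S.card.factorial : R) * ∏ c ∈ S, q a c)) *
          (1 + ∑ c, C (q a c) * X (Fin.natAdd h c)))) =
      coeff (∑ a ∈ V, Finsupp.single (Fin.castAdd h a) 1 +
        ∑ c ∈ W, Finsupp.single (Fin.natAdd h c) 1) F := by
  classical
  induction U using Finset.induction_on with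
  | empty => rw [Finset.prod_empty, mul_one]
  | insert a U ha ih =>
    rw [Finset.prod_insert ha, mul_left_comm F, mul_comm _ (F * _), coeff_mul_tinv_mul_affineY, ih]

/-- **Complementary products via truncated inverses.**  With `A_a = 1 + Σ_c q_{ac} y_c`,
`G = ∏_a A_a` and the truncated inverses `t_a`, for every `U`, `T`:
`coeff (E ∅ T) (∏_{a ∉ U} A_a) = coeff (E ∅ T) (G · ∏_{a ∈ U} t_a)`. -/
theorem coeff_complementary_eq_G_mul_tinv (q : Fin h → Fin h → R) (U T : Finset (Fin h)) :
    coeff (∑ a ∈ (∅ : Finset (Fin h)), Finsupp.single (Fin.castAdd h a) 1 +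
        ∑ c ∈ T, Finsupp.single (Fin.natAdd h c) 1)
        (∏ a ∈ Finset.univ \ U, (1 + ∑ c, C (q a c) * X (Fin.natAdd h c)) :
          MvPolynomial (Fin (h + h)) R) =
      coeff (∑ a ∈ (∅ : Finset (Fin h)), Finsupp.single (Fin.castAdd h a) 1 +
          ∑ c ∈ T, Finsupp.single (Fin.natAdd h c) 1)
        ((∏ a, (1 + ∑ c, C (q a c) * X (Fin.natAdd h c))) *
          ∏ a ∈ U, ∑ S ∈ (Finset.univ : Finset (Fin h)).powerset,
            monomial (∑ a' ∈ (∅ : Finset (Fin h)), Finsupp.single (Fin.castAdd h a') 1 +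
              ∑ c ∈ S, Finsupp.single (Fin.natAdd h c) 1)
              ((-1 : R) ^ S.card * (S.card.factorial : R) * ∏ c ∈ S, q a c)) := by
  classical
  -- `G · ∏_{a∈U} t_a = (∏_{a∉U} A_a) · ∏_{a∈U} (t_a · A_a)`
  have hG : (∏ a, (1 + ∑ c, C (q a c) * X (Fin.natAdd h c)) : MvPolynomial (Fin (h + h)) R) =
      (∏ a ∈ Finset.univ \ U, (1 + ∑ c, C (q a c) * X (Fin.natAdd h c))) *
        ∏ a ∈ U, (1 + ∑ c, C (q a c) * X (Fin.natAdd h c)) := by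
    rw [← Finset.prod_mul_prod_compl U, Finset.compl_eq_univ_sdiff, mul_comm]
  rw [hG, mul_assoc, ← Finset.prod_mul_distrib]
  have hcomm : (∏ a ∈ U, ((1 + ∑ c, C (q a c) * X (Fin.natAdd h c)) *
      ∑ S ∈ (Finset.univ : Finset (Fin h)).powerset,
        monomial (∑ a' ∈ (∅ : Finset (Fin h)), Finsupp.single (Fin.castAdd h a') 1 +
          ∑ c ∈ S, Finsupp.single (Fin.natAdd h c) 1)
          ((-1 : R) ^ S.card * (S.card.factorial : R) * ∏ c ∈ S, q a c)) :
            MvPolynomial (Fin (h + h)) R) =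
      ∏ a ∈ U, ((∑ S ∈ (Finset.univ : Finset (Fin h)).powerset,
        monomial (∑ a' ∈ (∅ : Finset (Fin h)), Finsupp.single (Fin.castAdd h a') 1 +
          ∑ c ∈ S, Finsupp.single (Fin.natAdd h c) 1)
          ((-1 : R) ^ S.card * (S.card.factorial : R) * ∏ c ∈ S, q a c)) *
        (1 + ∑ c, C (q a c) * X (Fin.natAdd h c))) :=
    Finset.prod_congr rfl fun a _ => mul_comm _ _
  rw [hcomm, coeff_mul_prod_tinv_mul_affineY]

/-- **x-PRIVATE ENTRIES VIA `Θ̂` AND `Γ`.**  For the x-private product `∏_a (x_a + A_a)`: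
`coeff (E U T) ∏_a (x_a + A_a) = Σ_{d ⊆ T} coeff (E ∅ (T ∖ d)) (∏_{a∈U} t_a) · coeff (E ∅ d) G`. -/
theorem coeff_xPrivate_eq_sum_thetaHat (q : Fin h → Fin h → R) (U T : Finset (Fin h)) :
    coeff (∑ a ∈ U, Finsupp.single (Fin.castAdd h a) 1 + ∑ c ∈ T, Finsupp.single (Fin.natAdd h c) 1)
        (∏ a, (X (Fin.castAdd h a) + (1 + ∑ c, C (q a c) * X (Fin.natAdd h c))) :
          MvPolynomial (Fin (h + h)) R) =
      ∑ d ∈ T.powerset,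
        coeff (∑ a ∈ (∅ : Finset (Fin h)), Finsupp.single (Fin.castAdd h a) 1 +
            ∑ c ∈ T \ d, Finsupp.single (Fin.natAdd h c) 1)
          (∏ a ∈ U, ∑ S ∈ (Finset.univ : Finset (Fin h)).powerset,
            monomial (∑ a' ∈ (∅ : Finset (Fin h)), Finsupp.single (Fin.castAdd h a') 1 +
              ∑ c ∈ S, Finsupp.single (Fin.natAdd h c) 1)
              ((-1 : R) ^ S.card * (S.card.factorial : R) * ∏ c ∈ S, q a c) :
                MvPolynomial (Fin (h + h)) R) *
        coeff (∑ a ∈ (∅ : Finset (Fin h)), Finsupp.single (Fin.castAdd h a) 1 +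
            ∑ c ∈ d, Finsupp.single (Fin.natAdd h c) 1)
          (∏ a, (1 + ∑ c, C (q a c) * X (Fin.natAdd h c)) : MvPolynomial (Fin (h + h)) R) := by
  classical
  have hAy : ∀ k, ∀ a : Fin h, Fin.castAdd h a ∉
      ((1 + ∑ c, C (q k c) * X (Fin.natAdd h c)) : MvPolynomial (Fin (h + h)) R).vars :=
    fun k => castAdd_notMem_vars_affineY (q k)
  have h1 := coeff_partitionExpo_xPrivate (R := R) (fun k => 1 + ∑ c, C (q k c) * X (Fin.natAdd h c))
    1 hAy (by intro a; rw [vars_one]; exact Finset.notMem_empty _) U T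
  rw [one_mul, one_mul] at h1
  rw [h1, coeff_complementary_eq_G_mul_tinv, mul_comm]
  exact coeff_partitionExpo_mul_yOnly _ _
    (support_castAdd_eq_zero_of_vars _ (castAdd_notMem_vars_prod _ _ fun k _ => hAy k)) ∅ T

/-- The constant coefficient of `G = ∏_a A_a` is `1`. -/
theorem coeff_empty_G (q : Fin h → Fin h → R) :
    coeff (∑ a ∈ (∅ : Finset (Fin h)), Finsupp.single (Fin.castAdd h a) 1 +
        ∑ c ∈ (∅ : Finset (Fin h)), Finsupp.single (Fin.natAdd h c) 1)
      (∏ a, (1 + ∑ c, C (q a c) * X (Fin.natAdd h c)) : MvPolynomial (Fin (h + h)) R) = 1 := by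
  classical
  rw [Finset.sum_empty, Finset.sum_empty, add_zero, ← constantCoeff_eq, map_prod]
  refine Finset.prod_eq_one fun a _ => ?_
  rw [map_add, map_one, map_sum]
  simp [constantCoeff_X]

/-! ## 3. The matrix factorisation on down-closed columns and `det Γ = 1` -/

/-- **`det Γ = 1`.**  For an injective family `δ`, the matrix
`Γ[j', j] = [δ j' ⊆ δ j] · g (δ j ∖ δ j')` with `g ∅ = 1` has determinant `1`
(block-triangular for the cardinality of `δ`, with identity diagonal blocks). -/
theorem det_gamma_eq_one {ι : Type*} [Fintype ι] [DecidableEq ι] (δ : ι → Finset (Fin h))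
    (hδ : Function.Injective δ) (g : Finset (Fin h) → R) (hg : g ∅ = 1) :
    (Matrix.of fun j' j => if δ j' ⊆ δ j then g (δ j \ δ j') else 0).det = 1 := by
  classical
  set M : Matrix ι ι R := Matrix.of fun j' j => if δ j' ⊆ δ j then g (δ j \ δ j') else 0 with hM
  have hbt : M.BlockTriangular (fun j => (δ j).card) := by
    intro j' j hlt
    rw [hM, Matrix.of_apply, if_neg]
    intro hsub
    exact absurd (Finset.card_le_card hsub) (not_le.mpr hlt)
  rw [Matrix.BlockTriangular.det hbt]
  refine Finset.prod_eq_one fun k _ => ?_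
  have hblock : M.toSquareBlock (fun j => (δ j).card) k = 1 := by
    ext x y
    simp only [Matrix.toSquareBlock_def, hM, Matrix.of_apply, Matrix.one_apply]
    by_cases hxy : x = y
    · subst hxy
      rw [if_pos (Finset.Subset.refl _), Finset.sdiff_self, hg, if_pos rfl]
    · have hne : (x : ι) ≠ (y : ι) := fun e => hxy (Subtype.ext e)
      rw [if_neg hxy, if_neg]
      intro hsub
      have hcard : (δ (x : ι)).card = (δ (y : ι)).card := x.2.trans y.2.symm
      exact hne (hδ (Finset.eq_of_subset_of_card_le hsub hcard.ge))
  rw [hblock, Matrix.det_one]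

/-- **Γ-REDUCTION (x-private design, down-closed columns).**  For rows `u : ι → Finset (Fin h)` and
an injective DOWN-CLOSED column family `δ`, the x-private coefficient matrix factors as `Θ̂ · Γ`. -/
theorem xPrivate_matrix_eq_thetaHat_mul {ι : Type*} [Fintype ι] [DecidableEq ι]
    (q : Fin h → Fin h → R) (u δ : ι → Finset (Fin h)) (hδ : Function.Injective δ)
    (hδcl : ∀ j, ∀ S, S ⊆ δ j → ∃ j', δ j' = S) :
    (Matrix.of fun i j => coeff
        (∑ a ∈ u i, Finsupp.single (Fin.castAdd h a) 1 + ∑ c ∈ δ j, Finsupp.single (Fin.natAdd h c) 1)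
        (∏ a, (X (Fin.castAdd h a) + (1 + ∑ c, C (q a c) * X (Fin.natAdd h c))) :
          MvPolynomial (Fin (h + h)) R)) =
      (Matrix.of fun i j' => coeff
        (∑ a ∈ (∅ : Finset (Fin h)), Finsupp.single (Fin.castAdd h a) 1 +
            ∑ c ∈ δ j', Finsupp.single (Fin.natAdd h c) 1)
          (∏ a ∈ u i, ∑ S ∈ (Finset.univ : Finset (Fin h)).powerset,
            monomial (∑ a' ∈ (∅ : Finset (Fin h)), Finsupp.single (Fin.castAdd h a') 1 +
              ∑ c ∈ S, Finsupp.single (Fin.natAdd h c) 1)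
              ((-1 : R) ^ S.card * (S.card.factorial : R) * ∏ c ∈ S, q a c) :
                MvPolynomial (Fin (h + h)) R)) *
      (Matrix.of fun j' j => if δ j' ⊆ δ j then coeff
        (∑ a ∈ (∅ : Finset (Fin h)), Finsupp.single (Fin.castAdd h a) 1 +
            ∑ c ∈ δ j \ δ j', Finsupp.single (Fin.natAdd h c) 1)
          (∏ a, (1 + ∑ c, C (q a c) * X (Fin.natAdd h c)) : MvPolynomial (Fin (h + h)) R) else 0) := by
  classical
  ext i j
  rw [Matrix.of_apply, Matrix.mul_apply, coeff_xPrivate_eq_sum_thetaHat]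
  simp only [Matrix.of_apply]
  -- reindex `d ⊆ δ j` as `δ j ∖ δ j'` over the `j'` with `δ j' ⊆ δ j`
  symm
  simp_rw [mul_ite, mul_zero]
  rw [← Finset.sum_filter]
  refine Finset.sum_bij (fun j' _ => δ j \ δ j') ?_ ?_ ?_ ?_
  · exact fun j' _ => Finset.mem_powerset.mpr Finset.sdiff_subset
  · intro j₁ hj₁ j₂ hj₂ e
    have h₁ : δ j₁ ⊆ δ j := (Finset.mem_filter.mp hj₁).2
    have h₂ : δ j₂ ⊆ δ j := (Finset.mem_filter.mp hj₂).2
    apply hδ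
    rw [← Finset.sdiff_sdiff_eq_self h₁, ← Finset.sdiff_sdiff_eq_self h₂]
    exact congrArg _ e
  · intro d hd
    have hdsub : d ⊆ δ j := Finset.mem_powerset.mp hd
    obtain ⟨j', hj'⟩ := hδcl j (δ j \ d) Finset.sdiff_subset
    refine ⟨j', Finset.mem_filter.mpr ⟨Finset.mem_univ _, ?_⟩, ?_⟩
    · rw [hj']
      exact Finset.sdiff_subset
    · rw [hj', Finset.sdiff_sdiff_eq_self hdsub]
  · exact fun j' hj' => by rw [Finset.sdiff_sdiff_eq_self (Finset.mem_filter.mp hj').2]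


/-- **Γ-REDUCTION, determinant form.**  For rows `u` and an injective DOWN-CLOSED column family `δ`
(both indexed by a finite type `ι`), the determinant of the x-private coefficient matrix
`[coeff (E (u i) (δ j)) ∏_a (x_a + A_a)]` equals `det Θ̂[u, δ]`,
`Θ̂[i, j] = coeff (E ∅ (δ j)) ∏_{a ∈ u i} t_a`. -/
theorem det_xPrivate_eq_det_thetaHat {ι : Type*} [Fintype ι] [DecidableEq ι]
    (q : Fin h → Fin h → R) (u δ : ι → Finset (Fin h)) (hδ : Function.Injective δ)
    (hδcl : ∀ j, ∀ S, S ⊆ δ j → ∃ j', δ j' = S) :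
    (Matrix.of fun i j => coeff
        (∑ a ∈ u i, Finsupp.single (Fin.castAdd h a) 1 + ∑ c ∈ δ j, Finsupp.single (Fin.natAdd h c) 1)
        (∏ a, (X (Fin.castAdd h a) + (1 + ∑ c, C (q a c) * X (Fin.natAdd h c))) :
          MvPolynomial (Fin (h + h)) R)).det =
      (Matrix.of fun i j' => coeff
        (∑ a ∈ (∅ : Finset (Fin h)), Finsupp.single (Fin.castAdd h a) 1 +
            ∑ c ∈ δ j', Finsupp.single (Fin.natAdd h c) 1)
          (∏ a ∈ u i, ∑ S ∈ (Finset.univ : Finset (Fin h)).powerset,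
            monomial (∑ a' ∈ (∅ : Finset (Fin h)), Finsupp.single (Fin.castAdd h a') 1 +
              ∑ c ∈ S, Finsupp.single (Fin.natAdd h c) 1)
              ((-1 : R) ^ S.card * (S.card.factorial : R) * ∏ c ∈ S, q a c) :
                MvPolynomial (Fin (h + h)) R)).det := by
  classical
  have hΓ : (Matrix.of fun j' j : ι => if δ j' ⊆ δ j then coeff
      (∑ a ∈ (∅ : Finset (Fin h)), Finsupp.single (Fin.castAdd h a) 1 +
          ∑ c ∈ δ j \ δ j', Finsupp.single (Fin.natAdd h c) 1)
        (∏ a, (1 + ∑ c, C (q a c) * X (Fin.natAdd h c)) : MvPolynomial (Fin (h + h)) R) else 0).det = 1 :=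
    det_gamma_eq_one δ hδ (fun S => coeff
      (∑ a ∈ (∅ : Finset (Fin h)), Finsupp.single (Fin.castAdd h a) 1 +
          ∑ c ∈ S, Finsupp.single (Fin.natAdd h c) 1)
        (∏ a, (1 + ∑ c, C (q a c) * X (Fin.natAdd h c)) : MvPolynomial (Fin (h + h)) R))
      (coeff_empty_G q)
  rw [xPrivate_matrix_eq_thetaHat_mul q u δ hδ hδcl, Matrix.det_mul, hΓ, mul_one]

/-! ## 4. The rows of `Θ̂` of size `≤ 1` -/

/-- Row `∅` of `Θ̂`: `coeff (E ∅ T) (∏_{a ∈ ∅} t_a) = [T = ∅]`. -/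
theorem thetaHat_empty_row (q : Fin h → Fin h → R) (T : Finset (Fin h)) :
    coeff (∑ a ∈ (∅ : Finset (Fin h)), Finsupp.single (Fin.castAdd h a) 1 +
        ∑ c ∈ T, Finsupp.single (Fin.natAdd h c) 1)
      (∏ a ∈ (∅ : Finset (Fin h)), ∑ S ∈ (Finset.univ : Finset (Fin h)).powerset,
        monomial (∑ a' ∈ (∅ : Finset (Fin h)), Finsupp.single (Fin.castAdd h a') 1 +
          ∑ c ∈ S, Finsupp.single (Fin.natAdd h c) 1)
          ((-1 : R) ^ S.card * (S.card.factorial : R) * ∏ c ∈ S, q a c) :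
            MvPolynomial (Fin (h + h)) R) = if T = ∅ then 1 else 0 := by
  classical
  rw [Finset.prod_empty, ← C_1, coeff_C]
  by_cases hT : T = ∅
  · subst hT
    rw [if_pos rfl, if_pos (by rw [Finset.sum_empty, Finset.sum_empty, add_zero])]
  · rw [if_neg hT, if_neg]
    exact fun e => hT ((partitionExpo_eq_iff ∅ ∅ ∅ T).mp (by rw [← e]; simp)).2.symm

/-- Row `{a}` of `Θ̂`: `coeff (E ∅ T) (∏_{a' ∈ {a}} t_{a'}) = (-1)^{|T|} |T|! ∏_{c∈T} q a c`. -/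
theorem thetaHat_singleton_row (q : Fin h → Fin h → R) (a : Fin h) (T : Finset (Fin h)) :
    coeff (∑ a' ∈ (∅ : Finset (Fin h)), Finsupp.single (Fin.castAdd h a') 1 +
        ∑ c ∈ T, Finsupp.single (Fin.natAdd h c) 1)
      (∏ a' ∈ ({a} : Finset (Fin h)), ∑ S ∈ (Finset.univ : Finset (Fin h)).powerset,
        monomial (∑ a'' ∈ (∅ : Finset (Fin h)), Finsupp.single (Fin.castAdd h a'') 1 +
          ∑ c ∈ S, Finsupp.single (Fin.natAdd h c) 1)
          ((-1 : R) ^ S.card * (S.card.factorial : R) * ∏ c ∈ S, q a' c) :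
            MvPolynomial (Fin (h + h)) R) =
      (-1 : R) ^ T.card * (T.card.factorial : R) * ∏ c ∈ T, q a c := by
  rw [Finset.prod_singleton, coeff_tinv]

end Summit.ValiantsHypothesis.ValiantsHypothesis.Theorems.BarrierLever.ChowCube
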